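import Summits.AtomisticToContinuum.FouriersLaw.Theses.EmbeddedDrudeMourre
import Literature.MathematicalPhysics.KineticTheory.ZeroWavenumberSpace
import Literature.MathematicalPhysics.KineticTheory.FluctuationFoelnerPositivity
import HarnessLib

/-!
# Stub C `stub_pencilDerivation`, tool: the Følner representation of the `ℋ₀` norm
(line `gram-pencil-harmonic-chaos`, crux `EmbeddedDrudeMourre.DrudeDissolution`,
item stmt-AtomisticToContinuum-12593; `--supports` file, closes nothing)

WHAT. On a probability space with a measure-preserving shift action `T` of `ℤ`, for `a ∈ L²(μ)` with
summable `x ↦ |Cov(a, a∘T_x)|`, the normalised variances of the Birkhoff sums converge to the summed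
two-point function, `n⁻¹ Var(Σ_{i<n} a∘T_i) → Σ_x Cov(a, a∘T_x)`, and are bounded by the clustering
norm, `Var(Σ_{i<n} a∘T_i) ≤ n Σ_x |Cov(a, a∘T_x)|` (`tendsto_inv_mul_variance_birkhoffSum`,
`variance_birkhoffSum_le`). For a zero-wavenumber datum `Z` of a chain this is the FØLNER
REPRESENTATION OF DOYON'S NORM, `‖[c]‖₀² = ⟨c, c⟩₀ = lim n⁻¹ Var(Σ_{i<n} c∘τ_i)`
(registered sub-goal `stub_pencilDerivation_foelner`).

WHY. It is the bridge from `ℋ₀(Z.μ)` to finite-volume `L²(μ)` quantities, along which the pointwise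
identity `u∘φ_t - u = ∫₀ᵗ (𝓛u)∘φ_s ds` passes to `ℋ₀` by Minkowski/AM–GM in `L²(μ)` and stationarity —
WITHOUT any uniform-in-time clustering (conjunct (ii-a) of stub C, file `…StubPencilDerivationDomain`).

PROOF. Adapted from `FluctuationFoelnerPositivity` (`tsum_covariance_comp_shift_nonneg`): by
stationarity `Var(Σ_{i<n} a∘T_i) = Σ_d N_n(d) c(d)`, `c(d) = Cov(a, a∘T_d)`, `N_n(d) = #{(i,j) ∈ [0,n)² :
j - i = d} ∈ [n - |d|, n]`; Tannery's theorem.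
-/

noncomputable section

open MeasureTheory ProbabilityTheory Filter Set Function Topology
open scoped InnerProductSpace ENNReal ProbabilityTheory
open Literature.MathematicalPhysics.KineticTheory
open Literature.MathematicalPhysics.KineticTheory.HeatConduction
open Literature.MathematicalPhysics.KineticTheory.PhononBoltzmann

namespace Summit.AtomisticToContinuum.FouriersLaw.Theorems.DrudeDissolution.GramPencilHarmonicChaos

section General

variable {Ω : Type*} [MeasurableSpace Ω] {μ : Measure Ω}

/-- **Fibre decomposition of the variance of a Birkhoff sum**: `Var(Σ_{i<n} a∘T_i) = Σ_d N_n(d) c(d)`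
with `c(d) = Cov(a, a∘T_d)` and `N_n(d)` the number of pairs `(i, j) ∈ [0,n)²` with `j - i = d`.
[folklore] -/
-- adapted from `Literature.MathematicalPhysics.KineticTheory.tsum_covariance_comp_shift_nonneg`
theorem variance_birkhoffSum_eq_tsum [IsProbabilityMeasure μ] (T : ShiftAction ℤ Ω)
    (hT : ∀ x, MeasurePreserving (T x) μ μ) {a : Ω → ℝ} (ha : MemLp a 2 μ) (n : ℕ) :
    Var[∑ i ∈ Finset.range n, a ∘ T (i : ℤ); μ] =
      ∑' d : ℤ, (((Finset.range n ×ˢ Finset.range n).filter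
        (fun p : ℕ × ℕ => (p.2 : ℤ) - p.1 = d)).card : ℝ) * cov[a, a ∘ T d; μ] := by
  classical
  set c : ℤ → ℝ := fun x => cov[a, a ∘ T x; μ] with hc
  have hmem : ∀ i : ℕ, MemLp (a ∘ T (i : ℤ)) 2 μ := fun i => ha.comp_measurePreserving (hT i)
  have hvar : Var[∑ i ∈ Finset.range n, a ∘ T (i : ℤ); μ] =
      ∑ p ∈ Finset.range n ×ˢ Finset.range n, c ((p.2 : ℤ) - p.1) := by
    rw [← covariance_self (memLp_finsetSum' _ fun i _ => hmem i).aestronglyMeasurable.aemeasurable,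
      covariance_sum_sum' (fun i _ => hmem i) (fun j _ => hmem j), Finset.sum_product]
    exact Finset.sum_congr rfl fun i _ => Finset.sum_congr rfl fun j _ =>
      covariance_comp_shift_comp_shift T hT ha.1 i j
  rw [hvar]
  set s := Finset.range n ×ˢ Finset.range n with hs
  set t : Finset ℤ := Finset.Ioo (-(n : ℤ)) n with ht
  have hmaps : ∀ p ∈ s, ((p.2 : ℤ) - p.1) ∈ t := by
    intro p hp
    obtain ⟨h1, h2⟩ := Finset.mem_product.1 hp
    have h1' := Finset.mem_range.1 h1
    have h2' := Finset.mem_range.1 h2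
    simp only [ht, Finset.mem_Ioo]
    omega
  rw [← Finset.sum_fiberwise_of_maps_to hmaps]
  have hinner : ∀ d ∈ t, ∑ p ∈ s with ((p.2 : ℤ) - p.1 = d), c ((p.2 : ℤ) - p.1) =
      ((s.filter (fun p : ℕ × ℕ => (p.2 : ℤ) - p.1 = d)).card : ℝ) * c d := by
    intro d _
    rw [Finset.sum_congr rfl (fun p hp => by rw [(Finset.mem_filter.1 hp).2]), Finset.sum_const,
      nsmul_eq_mul]
  rw [Finset.sum_congr rfl hinner]
  refine (tsum_eq_sum fun d hd => ?_).symm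
  have h0 : (s.filter (fun p : ℕ × ℕ => (p.2 : ℤ) - p.1 = d)).card = 0 := by
    refine Finset.card_eq_zero.2 (Finset.filter_eq_empty_iff.2 fun p hp h => hd ?_)
    exact h ▸ hmaps p hp
  rw [h0, Nat.cast_zero, zero_mul]

/-- **Clustering bound for Birkhoff sums**: `Var(Σ_{i<n} a∘T_i) ≤ n Σ_x |Cov(a, a∘T_x)|`. [folklore] -/
theorem variance_birkhoffSum_le [IsProbabilityMeasure μ] (T : ShiftAction ℤ Ω)
    (hT : ∀ x, MeasurePreserving (T x) μ μ) {a : Ω → ℝ} (ha : MemLp a 2 μ)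
    (hsum : Summable fun x : ℤ => |cov[a, a ∘ T x; μ]|) (n : ℕ) :
    Var[∑ i ∈ Finset.range n, a ∘ T (i : ℤ); μ] ≤ n * ∑' x : ℤ, |cov[a, a ∘ T x; μ]| := by
  rw [variance_birkhoffSum_eq_tsum T hT ha n, ← tsum_mul_left]
  have hs2 : Summable fun x : ℤ => (n : ℝ) * |cov[a, a ∘ T x; μ]| := hsum.mul_left _
  have hle : ∀ d : ℤ, (((Finset.range n ×ˢ Finset.range n).filter
      (fun p : ℕ × ℕ => (p.2 : ℤ) - p.1 = d)).card : ℝ) * cov[a, a ∘ T d; μ] ≤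
      (n : ℝ) * |cov[a, a ∘ T d; μ]| := by
    intro d
    have hN : (((Finset.range n ×ˢ Finset.range n).filter
        (fun p : ℕ × ℕ => (p.2 : ℤ) - p.1 = d)).card : ℝ) ≤ n := by
      exact_mod_cast card_filter_sub_eq_le n d
    calc _ ≤ (((Finset.range n ×ˢ Finset.range n).filter
          (fun p : ℕ × ℕ => (p.2 : ℤ) - p.1 = d)).card : ℝ) * |cov[a, a ∘ T d; μ]| :=
          mul_le_mul_of_nonneg_left (le_abs_self _) (Nat.cast_nonneg _)
      _ ≤ (n : ℝ) * |cov[a, a ∘ T d; μ]| := mul_le_mul_of_nonneg_right hN (abs_nonneg _)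
  have hs1 : Summable fun d : ℤ => (((Finset.range n ×ˢ Finset.range n).filter
      (fun p : ℕ × ℕ => (p.2 : ℤ) - p.1 = d)).card : ℝ) * cov[a, a ∘ T d; μ] := by
    refine Summable.of_norm_bounded hs2 fun d => ?_
    rw [Real.norm_eq_abs, abs_mul, Nat.abs_cast]
    refine mul_le_mul_of_nonneg_right ?_ (abs_nonneg _)
    exact_mod_cast card_filter_sub_eq_le n d
  exact hs1.tsum_le_tsum hle hs2

/-- **Følner limit of the normalised variances of Birkhoff sums**:
`n⁻¹ Var(Σ_{i<n} a∘T_i) → Σ_x Cov(a, a∘T_x)` (Tannery's theorem; Doyon 2022 Lemma 4.5, Spohn 1991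
Part I (7.6), lattice case). [folklore] -/
-- adapted from `Literature.MathematicalPhysics.KineticTheory.tsum_covariance_comp_shift_nonneg`
theorem tendsto_inv_mul_variance_birkhoffSum [IsProbabilityMeasure μ] (T : ShiftAction ℤ Ω)
    (hT : ∀ x, MeasurePreserving (T x) μ μ) {a : Ω → ℝ} (ha : MemLp a 2 μ)
    (hsum : Summable fun x : ℤ => |cov[a, a ∘ T x; μ]|) :
    Tendsto (fun n : ℕ => (n : ℝ)⁻¹ * Var[∑ i ∈ Finset.range n, a ∘ T (i : ℤ); μ]) atTop
      (𝓝 (∑' x : ℤ, cov[a, a ∘ T x; μ])) := by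
  classical
  set c : ℤ → ℝ := fun x => cov[a, a ∘ T x; μ] with hc
  obtain ⟨N, hN⟩ : ∃ N : ℕ → ℤ → ℕ, ∀ (n : ℕ) (d : ℤ),
      ((Finset.range n ×ˢ Finset.range n).filter (fun p : ℕ × ℕ => (p.2 : ℤ) - p.1 = d)).card = N n d :=
    ⟨_, fun _ _ => rfl⟩
  have hN_le : ∀ (n : ℕ) (d : ℤ), (N n d : ℝ) ≤ n := fun n d => by
    rw [← hN]; exact_mod_cast card_filter_sub_eq_le n d
  have hN_ge : ∀ (n : ℕ) (d : ℤ), (n : ℝ) - |(d : ℝ)| ≤ N n d := fun n d => by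
    rw [← hN]; exact sub_abs_le_card_filter_sub_eq n d
  have e : ∀ n : ℕ, (n : ℝ)⁻¹ * Var[∑ i ∈ Finset.range n, a ∘ T (i : ℤ); μ] =
      ∑' d : ℤ, ((N n d : ℝ) / n) * c d := by
    intro n
    rw [variance_birkhoffSum_eq_tsum T hT ha n, ← tsum_mul_left]
    refine tsum_congr fun d => ?_
    rw [hN]
    ring
  simp_rw [e]
  refine tendsto_tsum_of_dominated_convergence (bound := fun d => |c d|) hsum (fun d => ?_) ?_
  · have hw : Tendsto (fun n : ℕ => (N n d : ℝ) / n) atTop (𝓝 1) := by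
      have hlow : Tendsto (fun n : ℕ => 1 - |(d : ℝ)| / n) atTop (𝓝 1) := by
        have h := (tendsto_const_div_atTop_nhds_zero_nat |(d : ℝ)|)
        simpa using (tendsto_const_nhds (x := (1 : ℝ))).sub h
      refine tendsto_of_tendsto_of_tendsto_of_le_of_le' hlow tendsto_const_nhds ?_ ?_
      · filter_upwards [eventually_gt_atTop 0] with n hn
        have hn' : (0 : ℝ) < n := by exact_mod_cast hn
        rw [sub_le_iff_le_add, ← add_div, le_div_iff₀ hn', one_mul]
        linarith [hN_ge n d]
      · filter_upwards [eventually_gt_atTop 0] with n hn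
        have hn' : (0 : ℝ) < n := by exact_mod_cast hn
        rw [div_le_one hn']
        exact hN_le n d
    simpa using hw.mul_const (c d)
  · filter_upwards [eventually_gt_atTop 0] with n hn d
    have hn' : (0 : ℝ) < n := by exact_mod_cast hn
    rw [Real.norm_eq_abs, abs_mul, abs_div, Nat.abs_cast, Nat.abs_cast]
    refine mul_le_of_le_one_left (abs_nonneg _) ?_
    rw [div_le_one hn']
    exact hN_le n d

/-- **Second moment of a difference of two variables with equal means**:
`∫ (X - Y)² ≤ 2 Var X + 2 Var Y`. [folklore] -/
theorem integral_sub_sq_le_two_mul_variance_add [IsProbabilityMeasure μ] {X Y : Ω → ℝ}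
    (hX : MemLp X 2 μ) (hY : MemLp Y 2 μ) (hXY : μ[X] = μ[Y]) :
    ∫ ω, (X ω - Y ω) ^ 2 ∂μ ≤ 2 * Var[X; μ] + 2 * Var[Y; μ] := by
  have hiX : Integrable (fun ω => (X ω - μ[X]) ^ 2) μ := (hX.sub (memLp_const _)).integrable_sq
  have hiY : Integrable (fun ω => (Y ω - μ[Y]) ^ 2) μ := (hY.sub (memLp_const _)).integrable_sq
  rw [variance_eq_integral hX.aestronglyMeasurable.aemeasurable,
    variance_eq_integral hY.aestronglyMeasurable.aemeasurable, ← integral_const_mul, ← integral_const_mul,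
    ← integral_add (hiX.const_mul 2) (hiY.const_mul 2)]
  refine integral_mono ((hX.sub hY).integrable_sq) ((hiX.const_mul 2).add (hiY.const_mul 2)) fun ω => ?_
  have e : X ω - Y ω = (X ω - μ[X]) - (Y ω - μ[Y]) := by rw [hXY]; ring
  dsimp only
  rw [e]
  nlinarith [sq_nonneg ((X ω - μ[X]) + (Y ω - μ[Y]))]

/-- The time average over `[0, t]` as an average over the interval `Ι 0 t`:
`t⁻¹ ∫₀ᵗ f = |t|⁻¹ ∫_{Ι 0 t} f`. [folklore] -/
theorem inv_mul_intervalIntegral_eq (f : ℝ → ℝ) (t : ℝ) :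
    t⁻¹ * ∫ s in (0 : ℝ)..t, f s = |t|⁻¹ * ∫ s in Set.uIoc 0 t, f s := by
  rw [intervalIntegral.intervalIntegral_eq_integral_uIoc, smul_eq_mul, ← mul_assoc]
  congr 1
  split_ifs with h
  · rw [abs_of_nonneg h, mul_one]
  · rw [abs_of_neg (not_le.1 h), mul_neg_one, inv_neg]

end General

/-- **Følner representation of Doyon's norm** (registered sub-goal `stub_pencilDerivation_foelner`): for
a zero-wavenumber datum `Z` of a chain and an observable `c ∈ 𝒱`,
`n⁻¹ Var_μ(Σ_{i<n} c∘τ_i) → ⟨c, c⟩₀ = ‖[c]‖₀²`, and `Var_μ(Σ_{i<n} c∘τ_i) ≤ n Σ_x |Cov_μ(c, c∘τ_x)|`.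
[cite: Doyon2022, §4.1 Lemma 4.5] -/
theorem stub_pencilDerivation_foelner : ∀ (P : Literature.MathematicalPhysics.KineticTheory.HeatConduction.OscillatorChain) (D : Literature.MathematicalPhysics.KineticTheory.HeatConduction.InfiniteChainDynamics P) (Z : Literature.MathematicalPhysics.KineticTheory.HeatConduction.ZeroWavenumberData P D), ∀ c ∈ Z.localObs, Filter.Tendsto (fun n : ℕ => (n : ℝ)⁻¹ * ProbabilityTheory.variance (∑ i ∈ Finset.range n, c ∘ Literature.MathematicalPhysics.KineticTheory.HeatConduction.chainShift (i : ℤ)) Z.μ) Filter.atTop (nhds (Z.form c c)) ∧ ∀ n : ℕ, ProbabilityTheory.variance (∑ i ∈ Finset.range n, c ∘ Literature.MathematicalPhysics.KineticTheory.HeatConduction.chainShift (i : ℤ)) Z.μ ≤ n * ∑' x : ℤ, |ProbabilityTheory.covariance c (c ∘ Literature.MathematicalPhysics.KineticTheory.HeatConduction.chainShift x) Z.μ| := by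
  intro P D Z c hc
  have hsum : Summable fun x : ℤ => |cov[c, c ∘ chainShift x; Z.μ]| :=
    (integrable_count_iff.1 (Z.integrable_cov hc hc)).congr fun x => Real.norm_eq_abs _
  refine ⟨?_, variance_birkhoffSum_le chainShift Z.measurePreserving_shift (Z.memLp_of_mem hc) hsum⟩
  rw [Z.form_eq_tsum hc hc]
  exact tendsto_inv_mul_variance_birkhoffSum chainShift Z.measurePreserving_shift (Z.memLp_of_mem hc) hsum

end Summit.AtomisticToContinuum.FouriersLaw.Theorems.DrudeDissolution.GramPencilHarmonicChaos

end
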